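import Mathlib
import Summits.AtomisticToContinuum.Crystallization.Theorems.ChartedPlanarOrderExactShowsEverywhere
import Summits.AtomisticToContinuum.Crystallization.Theorems.ChartedPlanarOrderWindowExactOfMatched

/-!
# Stub credits for the registered line «coercive-straightening» on `ChartedZeroExcessLayered`

decomp-a2c lens-3 g11.  The skeleton `ChartedZeroExcessLayered_coercive_birth.lean` (sha256 bff08abb5bb2998d…,
registered on stmt-AtomisticToContinuum-26636, CRITIC-LEDGER row 136) has four stubs; two of them are TRUE-type
pieces already landed as theorems under other names.  This file proves those two stubs BY NAME AND SIGNATURE by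
citing the landed theorems, so that the ledger credits them and the line's open stubs are exactly
`stub_coerciveDefectBound` (C, residual) and `stub_zeroExcessScaleLock` (U₁, UNIQ/scale corner).

* `stub_windowExactOfMatched` = `ChartedPlanarOrderWindowExactOfMatched.windowExactOfMatched` (p782531; part 1 p782463).
* `stub_exactShowsEverywhere` = `ChartedPlanarOrderExactShowsEverywhere.exactShowsEverywhere` (p782196).
-/

namespace Summit.AtomisticToContinuum.Crystallization.Theorems.ChartedPlanarOrderCoerciveStubs

/-- Stub X of the registered skeleton (piece `WindowExactOfMatched`): matching at every tolerance with an
admissible scale ⟹ an exact layered Barlow pattern within radius `3b`.  [citation of the landed theorem] -/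
theorem stub_windowExactOfMatched :
    ∀ δ : ℝ, 0 < δ → ∀ Y : Set (EuclideanSpace ℝ (Fin 3)), (∀ x ∈ Y, ∀ y ∈ Y, x ≠ y → δ ≤ dist x y) → ∀ q ∈ Y, (∀ η : ℝ, 0 < η → ∃ b : ℝ, 9 / 10 ≤ b ∧ b ≤ 1 ∧ ∃ (A : EuclideanSpace ℝ (Fin 3) →ₗᵢ[ℝ] EuclideanSpace ℝ (Fin 3)) (s : ℤ → ℤ) (z : ℤ → ℝ), Literature.MathematicalPhysics.StatisticalMechanics.IsHaggSeq s ∧ (∀ m : ℤ, 39 / 50 * b ≤ z (m + 1) - z m ∧ z (m + 1) - z m ≤ 17 / 20 * b) ∧ z 0 = 0 ∧ (∀ y : EuclideanSpace ℝ (Fin 3), dist y q ≤ 4 * b → y ∈ Y → ∃ y' : EuclideanSpace ℝ (Fin 3), y' - q ∈ {p | ∃ m i j : ℤ, p = A (((i : ℝ) • Literature.MathematicalPhysics.StatisticalMechanics.triangularVec₁ b) + ((j : ℝ) • Literature.MathematicalPhysics.StatisticalMechanics.triangularVec₂ b) + ((Literature.MathematicalPhysics.StatisticalMechanics.haggLabel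 s m : ℝ) • Literature.MathematicalPhysics.StatisticalMechanics.barlowOffset b) + (z m • Literature.MathematicalPhysics.StatisticalMechanics.layerNormal 1))} ∧ dist y y' ≤ η) ∧ (∀ y' : EuclideanSpace ℝ (Fin 3), y' - q ∈ {p | ∃ m i j : ℤ, p = A (((i : ℝ) • Literature.MathematicalPhysics.StatisticalMechanics.triangularVec₁ b) + ((j : ℝ) • Literature.MathematicalPhysics.StatisticalMechanics.triangularVec₂ b) + ((Literature.MathematicalPhysics.StatisticalMechanics.haggLabel s m : ℝ) • Literature.MathematicalPhysics.StatisticalMechanics.barlowOffset b) + (z m • Literature.MathematicalPhysics.StatisticalMechanics.layerNormal 1))} → dist y' q ≤ 5 * b → ∃ y : EuclideanSpace ℝ (Fin 3), y ∈ Y ∧ dist y y' ≤ η)) → ∃ b : ℝ, 9 / 10 ≤ b ∧ b ≤ 1 ∧ ∃ (A : EuclideanSpace ℝ (Fin 3) →ₗᵢ[ℝ] EuclideanSpace ℝ (Fin 3)) (s : ℤ → ℤ) (z : ℤ → ℝ), Literature.MathematicalPhysics.StatisticalMechanics.IsHaggSeq s ∧ (∀ m : ℤ, 39 / 50 * b ≤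 z (m + 1) - z m ∧ z (m + 1) - z m ≤ 17 / 20 * b) ∧ z 0 = 0 ∧ ∀ y : EuclideanSpace ℝ (Fin 3), dist y q ≤ 3 * b → (y ∈ Y ↔ y - q ∈ {p | ∃ m i j : ℤ, p = A (((i : ℝ) • Literature.MathematicalPhysics.StatisticalMechanics.triangularVec₁ b) + ((j : ℝ) • Literature.MathematicalPhysics.StatisticalMechanics.triangularVec₂ b) + ((Literature.MathematicalPhysics.StatisticalMechanics.haggLabel s m : ℝ) • Literature.MathematicalPhysics.StatisticalMechanics.barlowOffset b) + (z m • Literature.MathematicalPhysics.StatisticalMechanics.layerNormal 1))}) :=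
  Summit.AtomisticToContinuum.Crystallization.Theorems.ChartedPlanarOrderWindowExactOfMatched.windowExactOfMatched

/-- Stub U₂ of the registered skeleton (piece `ExactShowsEverywhere`): a.s. root-exactness at scale `a` shows at
every point (Mecke re-rooting).  [citation of the landed theorem] -/
theorem stub_exactShowsEverywhere :
    ∀ a : ℝ, 0 < a → ∀ δ : ℝ, 0 < δ → ∀ P : MeasureTheory.Measure (MeasureTheory.Measure (EuclideanSpace ℝ (Fin 3))), MeasureTheory.IsProbabilityMeasure P → (∀ᵐ μ ∂P, (∃ S : Set (EuclideanSpace ℝ (Fin 3)), (0 : EuclideanSpace ℝ (Fin 3)) ∈ S ∧ (∀ x ∈ S, ∀ y ∈ S, x ≠ y → δ ≤ dist x y) ∧ μ = (MeasureTheory.Measure.count : MeasureTheory.Measure (EuclideanSpace ℝ (Fin 3))).restrict S)) → (∀ g : MeasureTheory.Measure (EuclideanSpace ℝ (Fin 3)) → EuclideanSpace ℝ (Fin 3) → ENNReal, Measurable (Function.uncurry g) → ∫⁻ μ, ∫⁻ y, g μ y ∂μ ∂P = ∫⁻ μ, ∫⁻ y, g (MeasureTheory.Measure.map (fun z => z -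 y) μ) (-y) ∂μ ∂P) → (∀ᵐ μ ∂P, ∃ (A : EuclideanSpace ℝ (Fin 3) →ₗᵢ[ℝ] EuclideanSpace ℝ (Fin 3)) (s : ℤ → ℤ) (z : ℤ → ℝ), Literature.MathematicalPhysics.StatisticalMechanics.IsHaggSeq s ∧ (∀ m : ℤ, 39 / 50 * a ≤ z (m + 1) - z m ∧ z (m + 1) - z m ≤ 17 / 20 * a) ∧ z 0 = 0 ∧ ∀ y : EuclideanSpace ℝ (Fin 3), dist y (0 : EuclideanSpace ℝ (Fin 3)) ≤ 3 * a → (μ {y} ≠ 0 ↔ y - (0 : EuclideanSpace ℝ (Fin 3)) ∈ {p | ∃ m i j : ℤ, p = A (((i : ℝ) • Literature.MathematicalPhysics.StatisticalMechanics.triangularVec₁ a) + ((j : ℝ) • Literature.MathematicalPhysics.StatisticalMechanics.triangularVec₂ a) + ((Literature.MathematicalPhysics.StatisticalMechanics.haggLabel s m : ℝ) • Literature.MathematicalPhysics.StatisticalMechanics.barlowOffset a) + (z m • Literature.MathematicalPhysics.StatisticalMechanics.layerNormal 1))})) → ∀ᵐ μ ∂P, ∀ q : EuclideanSpace ℝ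 (Fin 3), μ {q} ≠ 0 → ∃ (A : EuclideanSpace ℝ (Fin 3) →ₗᵢ[ℝ] EuclideanSpace ℝ (Fin 3)) (s : ℤ → ℤ) (z : ℤ → ℝ), Literature.MathematicalPhysics.StatisticalMechanics.IsHaggSeq s ∧ (∀ m : ℤ, 39 / 50 * a ≤ z (m + 1) - z m ∧ z (m + 1) - z m ≤ 17 / 20 * a) ∧ z 0 = 0 ∧ ∀ y : EuclideanSpace ℝ (Fin 3), dist y q ≤ 3 * a → (μ {y} ≠ 0 ↔ y - q ∈ {p | ∃ m i j : ℤ, p = A (((i : ℝ) • Literature.MathematicalPhysics.StatisticalMechanics.triangularVec₁ a) + ((j : ℝ) • Literature.MathematicalPhysics.StatisticalMechanics.triangularVec₂ a) + ((Literature.MathematicalPhysics.StatisticalMechanics.haggLabel s m : ℝ) • Literature.MathematicalPhysics.StatisticalMechanics.barlowOffset a) + (z m • Literature.MathematicalPhysics.StatisticalMechanics.layerNormal 1))}) :=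
  Summit.AtomisticToContinuum.Crystallization.Theorems.ChartedPlanarOrderExactShowsEverywhere.exactShowsEverywhere

end Summit.AtomisticToContinuum.Crystallization.Theorems.ChartedPlanarOrderCoerciveStubs
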